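import Summits.HodgeConjecture.HodgeConjecture.Theorems.F0P3XiEvpOfRecordSCDSigned   -- ★ p843355 (F0P3b-p01 (g7)): `hSCD_of_cmCharIdentityPackageTestSigned` + PIN `_fst` + `charIdentityAtTestSigned_hSCD`; brings A1ᴰ `xiPacketFamilyOfRecordSCD_of_nonsplit`
import HarnessLib

/-!
# Crux `H413`, programme P2 — (D7α) THE SHAPE OF THE SCD RECORD AT A NON-SPLIT PLACE, READ OFF THE **SIGNED** TEST PACKAGE
# (record-level pin + the SIGNED [13.1.4] on test functions for the record's own `πˢ`; the (H₄ᵀˢ) SHAPE hypothesis of ★ B2 `stubD7αMemDockPerMeasureT_of_rowsSigned` at the record)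

Cell `hodgecm-mathlib` (D-0151), FLOOR 0, crux item H413 = `stmt-HodgeConjecture-24833`, route of record `HCCMUnconditional`; programme P2, Day-X recipe of record
(LEAD F0P3a-plan (g13) T12-14 (3): «D7αᵀ ⟸ `stubD7αMemDockPerMeasureT_of_rowsSigned` ∘ closer rows, `Δ := Δ°` inside the node's ∃»); organ (B2-SCD) of F0P2-ref1 (g10)
objection ⑧ r353; seat F0P2-p06 (g14).  Helper file: THEOREMS ONLY (no definition, no named fact, no instance, no notation, no `sorry`);
`--supports stmt-HodgeConjecture-24833 --as helper`.  HONEST LABEL: HC_CM is proved only modulo the printed citations (2 remaining named inputs hLiu418 24832,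
h413 24833) until rung 0 closes; this file discharges none of them — it reads the closer's SIGNED Test-package binder `hQS : CMCharIdentityPackageTestSigned …`
(edition «QCMT SIGNED», RULING «K»).

WHAT — the SIGNED twin of ★ p840662 `F0P2oD7alphaShapeOfRecordSCD` (`hQT ↦ hQS`, `hSCD_of_cmCharIdentityPackageTest ↦ hSCD_of_cmCharIdentityPackageTestSigned`, the
identity conjunct SIGNED by the clause sign of the record's own frame).  ★ A1ᴰ `xiPacketFamilyOfRecordSCD … μZ keys hSC` is the ξ-local family of record on a supercuspidal
partner DATUM `hSC`; ★ `hSCD_of_cmCharIdentityPackageTestSigned … hQS` is the datum read off the SIGNED Test package (PIN `(…).1 = ((hQS ξ).1 v …).πs`, `rfl`), and ★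
`charIdentityAtTestSigned_hSCD` is the SIGNED identity for `⟨πⁿ ∘ e, some hSCD.1⟩`.  For the record AT THAT DATUM and every non-split `v`:

* `xiPacketFamilyOfRecordSCD_eq_of_packageTestSigned` — RECORD-LEVEL PIN: `∃ T a ha h, record ξ v = ⟨πⁿ ∘ e, some ((hQS ξ).1 v hns T a ha h (μZ v) π₂ πⁿ _ _).πs⟩`,
  `(π₂, πⁿ) = keys ξ v hns`;
* `shape_xiPacketFamilyOfRecordSCD_of_packageTestSigned` — the (H₄ᵀˢ) SHAPE hypothesis of ★ B2 `F0P2oD7alphaMemDockOfRowsSigned.stubD7αMemDockPerMeasureT_of_rowsSigned`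
  VERBATIM at `packFin := record`, `ξloc := fun ξ v => ξ.xiLocalChar v`: `∃ T a ha h π₂ πⁿ πˢ, Keys ∧ π₂ ∈ L² ∧ πⁿ ∉ L² ∧ πˢ supercuspidal ∧ πˢ ≠ πⁿ∘e ∧
  ⟨πⁿ∘e, some πˢ⟩.CharIdentityAtTest (fun c f => ε_v(a) · tr c(f dν_G)) … ∧ record ξ v = ⟨πⁿ∘e, some πˢ⟩`, `ε_v(a) = (if ∃ z, IsUnit z ∧ a = z·σz then 1 else −1)` the clause
  sign of THE SAME frame `(T, a)` (the token of ★ `CMNonsplitCharIdentityAtTestSigned` ∕ ★ `piSCompletion_isThetaTypeAtCMTestSigned` ∕ ★ B2).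

References: [Rogawski1990] §12.2 (2) pp. 173–174; §13.1 Prop. 13.1.3 (d), Prop. 13.1.4 p. 199; §13.3 pp. 201–202; §4.9 p. 55; §14.6 p. 242.  [LanglandsShelstad1987] §1.
-/

set_option autoImplicit false
-- the mandated namespace repeats `HodgeConjecture.HodgeConjecture`, as in every `Theorems/*.lean` of this sub-problem
set_option linter.dupNamespace false

noncomputable section

open NumberField IsDedekindDomain MeasureTheory
open scoped Matrix

namespace Summit.HodgeConjecture.HodgeConjecture.Cruxes.H413.F0P2oD7alphaShapeOfRecordSCDSigned

open Literature.NumberTheory Literature.NumberTheory.Automorphic Literature.NumberTheory.Automorphic.UnitaryGroup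
open Literature.NumberTheory.Rogawski1990 Literature.NumberTheory.GaloisRepresentations
open Summit.HodgeConjecture.HodgeConjecture.Cruxes.H413.F0P3XiPacketFamilyOfRecordSCD (xiPacketFamilyOfRecordSCD xiPacketFamilyOfRecordSCD_of_nonsplit
  hSCD_of_cmCharIdentityPackageTestSigned charIdentityAtTestSigned_hSCD)

variable (L : Type) [Field L] [NumberField L] [IsCMField L] (H : Matrix (Fin 3) (Fin 3) L)
  (hH : (H.map (cmConjRingHom L))ᵀ = H) (hHd : IsUnit H.det) (μω : HeckeCharacter L) (hμu : μω.IsUnitary)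
  [∀ v : HeightOneSpectrum (𝓞 ↥(maximalRealSubfield L)), MeasurableSpace ((cmDatum L 3 H).Local v)]
  [∀ v : HeightOneSpectrum (𝓞 ↥(maximalRealSubfield L)),
    MeasurableSpace ((cmDatum L 2 (Matrix.of fun i j : Fin 2 => if i.val + j.val + 1 = 2 then (1 : L) else 0)).Local v ×
      (cmDatum L 1 (Matrix.of fun i j : Fin 1 => if i.val + j.val + 1 = 1 then (1 : L) else 0)).Local v)]
  [∀ (v : HeightOneSpectrum (𝓞 ↥(maximalRealSubfield L)))
      (a : ((cmDatum L 2 (Matrix.of fun i j : Fin 2 => if i.val + j.val + 1 = 2 then (1 : L) else 0)).Local v ×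
        (cmDatum L 1 (Matrix.of fun i j : Fin 1 => if i.val + j.val + 1 = 1 then (1 : L) else 0)).Local v)),
    MeasurableSpace (((cmDatum L 2 (Matrix.of fun i j : Fin 2 => if i.val + j.val + 1 = 2 then (1 : L) else 0)).Local v ×
        (cmDatum L 1 (Matrix.of fun i j : Fin 1 => if i.val + j.val + 1 = 1 then (1 : L) else 0)).Local v) ⧸
      Subgroup.centralizer ({a} : Set ((cmDatum L 2 (Matrix.of fun i j : Fin 2 => if i.val + j.val + 1 = 2 then (1 : L) else 0)).Local v ×
        (cmDatum L 1 (Matrix.of fun i j : Fin 1 => if i.val + j.val + 1 = 1 then (1 : L) else 0)).Local v)))]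
  [∀ (v : HeightOneSpectrum (𝓞 ↥(maximalRealSubfield L))) (γ : (cmDatum L 3 H).Local v),
    MeasurableSpace ((cmDatum L 3 H).Local v ⧸ Subgroup.centralizer ({γ} : Set ((cmDatum L 3 H).Local v)))]
  [∀ v : HeightOneSpectrum (𝓞 ↥(maximalRealSubfield L)), MeasurableSpace (Gqs L v ⧸ Subgroup.center (Gqs L v))]
  (Δ : ∀ v : HeightOneSpectrum (𝓞 ↥(maximalRealSubfield L)), LocalTransferFactor L H v)
  (mH : ∀ v : HeightOneSpectrum (𝓞 ↥(maximalRealSubfield L)),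
    OrbitalMeasureFamily ((cmDatum L 2 (Matrix.of fun i j : Fin 2 => if i.val + j.val + 1 = 2 then (1 : L) else 0)).Local v ×
      (cmDatum L 1 (Matrix.of fun i j : Fin 1 => if i.val + j.val + 1 = 1 then (1 : L) else 0)).Local v))
  (mG : ∀ v : HeightOneSpectrum (𝓞 ↥(maximalRealSubfield L)), OrbitalMeasureFamily ((cmDatum L 3 H).Local v))
  (νG : ∀ v : HeightOneSpectrum (𝓞 ↥(maximalRealSubfield L)), Measure ((cmDatum L 3 H).Local v))
  (νH : ∀ v : HeightOneSpectrum (𝓞 ↥(maximalRealSubfield L)),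
    Measure ((cmDatum L 2 (Matrix.of fun i j : Fin 2 => if i.val + j.val + 1 = 2 then (1 : L) else 0)).Local v ×
      (cmDatum L 1 (Matrix.of fun i j : Fin 1 => if i.val + j.val + 1 = 1 then (1 : L) else 0)).Local v))
  (μZ : ∀ v : HeightOneSpectrum (𝓞 ↥(maximalRealSubfield L)), Measure (Gqs L v ⧸ Subgroup.center (Gqs L v)))
  [∀ v : HeightOneSpectrum (𝓞 ↥(maximalRealSubfield L)), BorelSpace (Gqs L v ⧸ Subgroup.center (Gqs L v))]
  [∀ v : HeightOneSpectrum (𝓞 ↥(maximalRealSubfield L)), (μZ v).IsHaarMeasure]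
  (keys : ∀ (ξ : OneDimAutRepH L) (v : HeightOneSpectrum (𝓞 ↥(maximalRealSubfield L))),
    (∀ w : PlacesOver L v, IsCMField.complexConj L • w.1 = w.1) →
      {p : IrrClass (Gqs L v) × IrrClass (Gqs L v) //
        KeysCaseTwoLabels L v (μω.semilocalComponent L v) (torusLocalComponent L (IsCMField.complexConj L) v ξ.η)
          (torusLocalComponent L (IsCMField.complexConj L) v ξ.ψ) p.1 p.2 ∧
        p.1.IsSquareIntegrable (μZ v) ∧ ¬ p.2.IsSquareIntegrable (μZ v)})
  (hQS : CMCharIdentityPackageTestSigned L H hH hHd νH νG μω hμu Δ mH mG)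

/-- **RECORD-LEVEL PIN (SIGNED PACKAGE).**  At a non-split `v`, the SCD record at the SIGNED Test-package datum is `⟨πⁿ ∘ e, some πˢ⟩` with `πⁿ = (keys ξ v hns).πn` and
`πˢ = ((hQS ξ).1 v …).πs` THE class read off the SIGNED [13.1.4] on test functions (★ A1ᴰ's packet-level choice + the `rfl` pin ★ `hSCD_of_cmCharIdentityPackageTestSigned_fst`).
[cite: Rogawski1990, §12.2 (2) pp. 173–174; §13.1 Prop. 13.1.4 p. 199; §14.6 p. 242] -/
theorem xiPacketFamilyOfRecordSCD_eq_of_packageTestSigned (ξ : OneDimAutRepH L) (v : HeightOneSpectrum (𝓞 ↥(maximalRealSubfield L)))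
    (hns : ∀ w : PlacesOver L v, IsCMField.complexConj L • w.1 = w.1) :
    ∃ (T : GL (Fin 3) (LocalRing L v)) (a : LocalRing L v) (ha : IsUnit a)
      (h : formCongr (conjLocal L (IsCMField.complexConj L) v) T (H.map (algebraMap L (LocalRing L v))) =
        a • (Matrix.of fun i j : Fin 3 => if i.val + j.val + 1 = 3 then (1 : L) else 0).map (algebraMap L (LocalRing L v))),
      xiPacketFamilyOfRecordSCD L H hH hHd μω hμu μZ keys
          (hSCD_of_cmCharIdentityPackageTestSigned L H hH hHd μω hμu Δ mH mG νG νH μZ hQS) ξ v =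
        ⟨IrrClass.comap (cmDatumLocalCongr L v T ha h).symm (keys ξ v hns).1.2,
          some ((hQS ξ).1 v hns T a ha h (μZ v) (keys ξ v hns).1.1 (keys ξ v hns).1.2 (keys ξ v hns).2.1 (keys ξ v hns).2.2.2).πs⟩ := by
  obtain ⟨T, a, ha, h, hP, -⟩ := xiPacketFamilyOfRecordSCD_of_nonsplit L H hH hHd μω hμu μZ keys
    (hSCD_of_cmCharIdentityPackageTestSigned L H hH hHd μω hμu Δ mH mG νG νH μZ hQS) ξ v hns
  exact ⟨T, a, ha, h, hP⟩

open scoped Classical in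
/-- **SHAPE OF THE SCD RECORD AT A NON-SPLIT PLACE, SIGNED** — the (H₄ᵀˢ) hypothesis of ★ B2 `F0P2oD7alphaMemDockOfRowsSigned.stubD7αMemDockPerMeasureT_of_rowsSigned` VERBATIM at
`packFin := xiPacketFamilyOfRecordSCD … (hSCD_of_cmCharIdentityPackageTestSigned … hQS)` and `ξloc ξ v := ξ.xiLocalChar v`: Keys labels, `π₂ ∈ L²`, `πⁿ ∉ L²`, `πˢ`
supercuspidal and `≠ πⁿ ∘ e`, the SIGNED [13.1.4] on test functions for `⟨πⁿ ∘ e, some πˢ⟩` with member traces `f ↦ ε_v(a)·tr c(f dν_G)` at the record's own frame `(T, a)`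
(★ `charIdentityAtTestSigned_hSCD`), and the record IS that packet. [cite: Rogawski1990, §12.2 (2) pp. 173–174; §13.1 Prop. 13.1.3 (d), Prop. 13.1.4 p. 199; §14.6 p. 242]
[cite: LanglandsShelstad1987, §1] -/
theorem shape_xiPacketFamilyOfRecordSCD_of_packageTestSigned (ξ : OneDimAutRepH L) (v : HeightOneSpectrum (𝓞 ↥(maximalRealSubfield L)))
    (hns : ∀ w : PlacesOver L v, IsCMField.complexConj L • w.1 = w.1) :
    ∃ (T : GL (Fin 3) (LocalRing L v)) (a : LocalRing L v) (ha : IsUnit a)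
      (h : formCongr (conjLocal L (IsCMField.complexConj L) v) T (H.map (algebraMap L (LocalRing L v))) =
        a • (Matrix.of fun i j : Fin 3 => if i.val + j.val + 1 = 3 then (1 : L) else 0).map (algebraMap L (LocalRing L v)))
      (π2 πn : IrrClass (Gqs L v)) (πs : IrrClass ((cmDatum L 3 H).Local v)),
      KeysCaseTwoLabels L v (μω.semilocalComponent L v) (torusLocalComponent L (IsCMField.complexConj L) v ξ.η)
          (torusLocalComponent L (IsCMField.complexConj L) v ξ.ψ) π2 πn ∧
        π2.IsSquareIntegrable (μZ v) ∧ ¬ πn.IsSquareIntegrable (μZ v) ∧ πs.IsSupercuspidal ∧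
        πs ≠ IrrClass.comap (cmDatumLocalCongr L v T ha h).symm πn ∧
        (⟨IrrClass.comap (cmDatumLocalCongr L v T ha h).symm πn, some πs⟩ : CMLocalAPacket L H v).CharIdentityAtTest L H v
          (fun c f => (if ∃ z : LocalRing L v, IsUnit z ∧ a = z * conjLocal L (IsCMField.complexConj L) v z then (1 : ℂ) else -1) * c.smoothTrace (νG v) f)
          (ξ.xiLocalChar v) (νH v) (Δ v) (mH v) (mG v) ∧
        xiPacketFamilyOfRecordSCD L H hH hHd μω hμu μZ keys
            (hSCD_of_cmCharIdentityPackageTestSigned L H hH hHd μω hμu Δ mH mG νG νH μZ hQS) ξ v =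
          ⟨IrrClass.comap (cmDatumLocalCongr L v T ha h).symm πn, some πs⟩ := by
  obtain ⟨T, a, ha, h, hP, -⟩ := xiPacketFamilyOfRecordSCD_of_nonsplit L H hH hHd μω hμu μZ keys
    (hSCD_of_cmCharIdentityPackageTestSigned L H hH hHd μω hμu Δ mH mG νG νH μZ hQS) ξ v hns
  exact ⟨T, a, ha, h, (keys ξ v hns).1.1, (keys ξ v hns).1.2, _, (keys ξ v hns).2.1, (keys ξ v hns).2.2.1, (keys ξ v hns).2.2.2,
    (hSCD_of_cmCharIdentityPackageTestSigned L H hH hHd μω hμu Δ mH mG νG νH μZ hQS ξ v hns T a ha h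
      (keys ξ v hns).1.1 (keys ξ v hns).1.2 (keys ξ v hns).2.1 (keys ξ v hns).2.2.2).2.1,
    (hSCD_of_cmCharIdentityPackageTestSigned L H hH hHd μω hμu Δ mH mG νG νH μZ hQS ξ v hns T a ha h
      (keys ξ v hns).1.1 (keys ξ v hns).1.2 (keys ξ v hns).2.1 (keys ξ v hns).2.2.2).2.2,
    charIdentityAtTestSigned_hSCD L H hH hHd μω hμu Δ mH mG νG νH μZ hQS ξ v hns T a ha h
      (keys ξ v hns).1.1 (keys ξ v hns).1.2 (keys ξ v hns).2.1 (keys ξ v hns).2.2.2, hP⟩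

end Summit.HodgeConjecture.HodgeConjecture.Cruxes.H413.F0P2oD7alphaShapeOfRecordSCDSigned

end
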